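import Literature.Analysis.DeBrangesSpaces.BurnolXPairingFourierSwap
import Literature.Analysis.DeBrangesSpaces.BurnolSonineEvaluatorIndependenceProofs
import Literature.NumberTheory.LFunctions.SonineMellinFunctionalEquation
import Mathlib.MeasureTheory.Function.JacobianOneDim
import HarnessLib

/-!
# Burnol 2001 (CRAS 333), Théorème 2.3 from Théorème 1.5: linear independence of the evaluators
# `Z^Λ_{w,k}` of `H_Λ`, transported from `K_{1/Λ}` by `I f(t) = f(1/t)/t`

LINE 1 — LABEL: RH-FREE (Hilbert-space bookkeeping on Burnol's spaces `H_Λ = I K_{1/Λ}`; the Riemann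
zeta function does not occur). FRAMING (cell rh-crit, D-0074): corpus theorems are RH-FREE literature;
nothing here is worded as progress toward RH. bears_on: B-C/B-P (LADDER-RH COLUMN 6, de Branges
framework). WHAT THIS IS NOT: not a route, not a criterion; linear independence of evaluators is corpus
vocabulary and moves RH by nothing. Nothing here bears on the truth of RH.

Source: J.-F. Burnol, *Sur certains espaces de Hilbert de fonctions entières, liés à la transformation
de Fourier et aux fonctions L de Dirichlet et de Riemann*, C. R. Acad. Sci. Paris Sér. I **333** (2001)
201–206 = arXiv:math/0105120 [Burnol2001CRAS] (TeX of record `dbl/src/Burnol2001CRAS_arXivmath0105120.tex`),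
§2: "On a `H_Λ = I K_{λ,λ}` avec `λ = 1/Λ`" (TeX l.418), Proposition 2.2 (the evaluators `Z^Λ_{w,k}`,
`(f, Z^Λ_{w,k}] = M(f)^{(k)}(w)`, TeX l.463–466) and **Théorème 2.3** (TeX l.475–477): *Les vecteurs
`Z^Λ_{w,k}` pour `w ∈ ℂ`, `k ∈ ℕ` sont linéairement indépendants (en particulier ils sont tous non
nuls)* — typed in `BurnolSonineSpaces.lean` as `Burnol2001.Burnol2001CRAS_thm2_3`; the Note gives no
separate proof ("Les preuves de 1.5 et de 2.3 sont semblables", cf. TeX l.409–420 for 1.5).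

## What is PROVED (theorem-only module: no definition, no named fact)

* `Burnol2001.Burnol2001CRAS_thm2_3_of_thm1_5C : Burnol2001CRAS_thm1_5C → Burnol2001CRAS_thm2_3` —
  Théorème 2.3 follows from Théorème 1.5 (faithful form `Burnol2001CRAS_thm1_5C`, linear independence of
  the pairing functionals `f ↦ (f, X^λ_{w,k}]` on `K_{λ,λ}`) by the unitary involution `I`:
  1. (`§1`, transport) for `k ∈ K_λ` the class `Ik` of `t ↦ k(t⁻¹)/|t|` satisfies `memHLambda λ⁻¹`
     (private copies of the plumbing of `BurnolHLambdaDensityProofs.lean`);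
  2. (`§2`, Mellin side) `∫₀^∞ (Ik)(t)t^{s−1}dt = k̂(1−s)` (right Mellin transform of `k`), so the ENTIRE
     completed transform `𝒢_k = completedMellinEntire k` of Burnol 2004 (tree theorem
     `hasCompletedMellinEntire_of_mem_sonineK`, de Branges) is a completed Mellin transform of `Ik` in the
     sense `IsCompletedMellin` of Prop. 2.2;
  3. (`§3`, dictionary) with `(G, P)` the Mellin data of `k` (Théorème 1.1 and eq. (1.1):
     `G = G_k`, `P = G_{𝓕k}` — tree theorems `HasEntireMellin.eq_sonineMellinExt`,
     `IsXPairingFnC.eq_sonineMellinExt`), `𝒢_k(v) = Γ_ℝ(v)·G(1−v)` wherever `Γ_ℝ(v) ≠ 0` and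
     `𝒢_k(v) = Γ_ℝ(1−v)·P(v)` wherever `Γ_ℝ(1−v) ≠ 0` (functional equation `𝒢_{𝓕k}(s) = 𝒢_k(1−s)`),
     whence by Leibniz' rule `𝒢_k^{(n)}(w) = Σ_{i≤n} C(n,i)·(k, X^λ_{w,i}]·h_w^{(n−i)}(w)` with
     `h_w = Γ_ℝ` (`Re w > 1/2`) or `h_w = Γ_ℝ(1−·)` (`Re w ≤ 1/2`), `h_w(w) ≠ 0`;
  4. (`§4`) a vanishing combination `Σ c_{w,k} Z^Λ_{w,k} = 0` gives `Σ c_{w,k} 𝒢_k^{(k)}(w) = 0` for all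
     `k ∈ K_λ`, i.e. (by 3) a vanishing combination of the pairing functionals with coefficients obtained
     from `c` by an invertible triangular substitution; Théorème 1.5 kills them, hence `c = 0`.

* `Burnol2001.Burnol2001CRAS_thm2_3_holds : Burnol2001CRAS_thm2_3` — the DISCHARGE, from the door and
  the tree theorem `Burnol2001CRAS_thm1_5C_holds` (`BurnolSonineEvaluatorIndependenceProofs.lean`,
  Théorème 1.5 proved).

## References
* [Burnol2001CRAS] C. R. Acad. Sci. Paris Sér. I 333 (2001) 201–206, §2 (TeX l.410–418, 445–477).
* [Burnol2004b] J. Théor. Nombres Bordeaux 16 (2004) 65–94, Thm. 2.1 (the entire completed Mellin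
  transform on `K_a`; tree `completedMellinEntire`).
-/

noncomputable section

open _root_.MeasureTheory _root_.Complex _root_.Set _root_.Filter FourierTransform
open scoped Topology ENNReal Real
open Literature.NumberTheory.LFunctions
open Literature.NumberTheory.ConnesConsani2021 (soninSpace)
open Literature.Analysis.DeBrangesSpaces.SonineMellin (sonineMellinExt differentiable_sonineMellinExt
  sonineMellinExt_eq_mellin)

namespace Literature.Analysis.DeBrangesSpaces

namespace Burnol2001

section InversionTransport

/-! ### §1. The inversion `t ↦ 1/t` on `(ℝ, dt)` and the transport `K_λ → H_{1/λ}`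
(private copies of the plumbing of `BurnolHLambdaDensityProofs.lean`) -/

/-- `t ↦ t⁻¹` is quasi-measure-preserving for Lebesgue measure. [folklore] -/
private theorem quasiMeasurePreserving_inv_real :
    Measure.QuasiMeasurePreserving (fun t : ℝ ↦ t⁻¹) volume volume := by
  refine ⟨measurable_inv, Measure.AbsolutelyContinuous.mk fun N hN hN0 ↦ ?_⟩
  rw [Measure.map_apply measurable_inv hN]
  have hsub : (fun t : ℝ ↦ t⁻¹) ⁻¹' N ⊆ (fun t : ℝ ↦ t⁻¹) '' (N \ {0}) ∪ {0} := by
    intro t ht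
    by_cases ht0 : t = 0
    · exact Or.inr ht0
    · exact Or.inl ⟨t⁻¹, ⟨ht, inv_ne_zero ht0⟩, inv_inv t⟩
  have hdiff : DifferentiableOn ℝ (fun t : ℝ ↦ t⁻¹) (N \ {0}) :=
    fun t ht ↦ (hasDerivAt_inv ht.2).differentiableAt.differentiableWithinAt
  have h1 : volume ((fun t : ℝ ↦ t⁻¹) '' (N \ {0})) = 0 :=
    addHaar_image_eq_zero_of_differentiableOn_of_addHaar_eq_zero volume hdiff
      (measure_mono_null (fun x hx ↦ hx.1) hN0)
  exact measure_mono_null hsub (measure_union_null h1 (measure_singleton 0))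

/-- Almost every real number is non-zero. [folklore] -/
private theorem ae_ne_zero_real : ∀ᵐ t : ℝ, t ≠ 0 := by
  have : ({0}ᶜ : Set ℝ) ∈ ae (volume : Measure ℝ) := compl_mem_ae_iff.2 (measure_singleton 0)
  filter_upwards [this] with t ht
  exact ht

/-- `ℝ ∖ {0}` has full measure. [folklore] -/
private theorem compl_zero_ae_eq_univ : (({0}ᶜ : Set ℝ)) =ᵐ[volume] (univ : Set ℝ) :=
  ae_eq_univ.2 (by rw [compl_compl]; exact measure_singleton (0 : ℝ))

/-- The image of `ℝ ∖ {0}` under `t ↦ t⁻¹` is `ℝ ∖ {0}`. [folklore] -/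
private theorem image_inv_compl_zero :
    (fun t : ℝ ↦ t⁻¹) '' ({0}ᶜ : Set ℝ) = ({0}ᶜ : Set ℝ) := by
  ext x
  simp only [mem_image, mem_compl_iff, mem_singleton_iff]
  constructor
  · rintro ⟨t, ht, rfl⟩
    exact inv_ne_zero ht
  · intro hx
    exact ⟨x⁻¹, inv_ne_zero hx, inv_inv x⟩

/-- `‖k(t⁻¹)/|t|‖² = |−(t²)⁻¹| · ‖k(t⁻¹)‖²`. [folklore] -/
private theorem norm_sq_invT_eq (k : ℝ → ℂ) (t : ℝ) :
    ‖k t⁻¹ / ((|t| : ℝ) : ℂ)‖ ^ 2 = |(-(t ^ 2)⁻¹ : ℝ)| • ‖k t⁻¹‖ ^ 2 := by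
  rw [norm_div, Complex.norm_real, Real.norm_eq_abs, abs_abs, div_pow, abs_neg, abs_inv, abs_pow,
    sq_abs, smul_eq_mul]
  ring

/-- The inversion `k ↦ k(1/t)/|t|` preserves `L²(ℝ)` ("`I` est unitaire").
[cite: Burnol2001CRAS, §1 (TeX l.302)] -/
private theorem memLp_invT (k : Lp ℂ 2 (volume : Measure ℝ)) :
    MemLp (fun t : ℝ ↦ (k : ℝ → ℂ) t⁻¹ / ((|t| : ℝ) : ℂ)) 2 volume := by
  have hmeas : AEStronglyMeasurable (fun t : ℝ ↦ (k : ℝ → ℂ) t⁻¹ / ((|t| : ℝ) : ℂ)) volume := by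
    have h1 : AEStronglyMeasurable (fun t : ℝ ↦ (k : ℝ → ℂ) t⁻¹) volume :=
      (Lp.aestronglyMeasurable k).comp_quasiMeasurePreserving quasiMeasurePreserving_inv_real
    have h2 : AEStronglyMeasurable (fun t : ℝ ↦ (((|t| : ℝ) : ℂ))⁻¹) volume :=
      (Complex.continuous_ofReal.measurable.comp measurable_abs).inv.aestronglyMeasurable
    exact (h1.mul h2).congr (Eventually.of_forall fun t ↦ (div_eq_mul_inv _ _).symm)
  rw [memLp_two_iff_integrable_sq_norm hmeas]
  have hG : Integrable (fun x : ℝ ↦ ‖(k : ℝ → ℂ) x‖ ^ 2) volume :=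
    (memLp_two_iff_integrable_sq_norm (Lp.memLp k).1).1 (Lp.memLp k)
  have hderiv : ∀ t ∈ ({0}ᶜ : Set ℝ), HasDerivWithinAt (fun t : ℝ ↦ t⁻¹) (-(t ^ 2)⁻¹) ({0}ᶜ : Set ℝ) t :=
    fun t ht ↦ (hasDerivAt_inv ht).hasDerivWithinAt
  have hinj : InjOn (fun t : ℝ ↦ t⁻¹) ({0}ᶜ : Set ℝ) := inv_injective.injOn
  have hOn : IntegrableOn (fun t : ℝ ↦ |(-(t ^ 2)⁻¹ : ℝ)| • ‖(k : ℝ → ℂ) t⁻¹‖ ^ 2) ({0}ᶜ : Set ℝ) := by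
    rw [← integrableOn_image_iff_integrableOn_abs_deriv_smul (measurableSet_singleton 0).compl hderiv
      hinj (fun x : ℝ ↦ ‖(k : ℝ → ℂ) x‖ ^ 2), image_inv_compl_zero]
    exact hG.integrableOn
  have hOn' : IntegrableOn (fun t : ℝ ↦ ‖(k : ℝ → ℂ) t⁻¹ / ((|t| : ℝ) : ℂ)‖ ^ 2) ({0}ᶜ : Set ℝ) :=
    hOn.congr_fun (fun t _ ↦ (norm_sq_invT_eq _ t).symm) (measurableSet_singleton 0).compl
  have huniv : IntegrableOn (fun t : ℝ ↦ ‖(k : ℝ → ℂ) t⁻¹ / ((|t| : ℝ) : ℂ)‖ ^ 2) (univ : Set ℝ) :=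
    hOn'.congr_set_ae compl_zero_ae_eq_univ.symm
  exact integrableOn_univ.1 huniv

/-- `I` is an involution (a.e. form, the shape of the `g`-clause of `memHLambda`): with `f = Ik`,
`k(t) = f(t⁻¹)/|t|` for a.e. `t`. [cite: Burnol2001CRAS, §1–2 (TeX l.302, 410–418)] -/
private theorem ae_invT_invT (k : Lp ℂ 2 (volume : Measure ℝ)) :
    ∀ᵐ t : ℝ, (k : ℝ → ℂ) t =
      ((memLp_invT k).toLp (fun t : ℝ ↦ (k : ℝ → ℂ) t⁻¹ / ((|t| : ℝ) : ℂ)) : ℝ → ℂ) t⁻¹ /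
        ((|t| : ℝ) : ℂ) := by
  have hae := (memLp_invT k).coeFn_toLp
  have hae' := quasiMeasurePreserving_inv_real.ae hae
  filter_upwards [hae', ae_ne_zero_real] with t ht ht0
  rw [ht, inv_inv, abs_inv]
  have h : ((|t| : ℝ) : ℂ) ≠ 0 := by exact_mod_cast (abs_pos.2 ht0).ne'
  push_cast
  field_simp

/-- `I` preserves evenness. [folklore] -/
private theorem toLp_invT_mem_evenL2 {k : Lp ℂ 2 (volume : Measure ℝ)} (hk : k ∈ evenL2) :
    (memLp_invT k).toLp (fun t : ℝ ↦ (k : ℝ → ℂ) t⁻¹ / ((|t| : ℝ) : ℂ)) ∈ evenL2 := by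
  have hk' : ∀ᵐ u : ℝ, (k : ℝ → ℂ) (-u) = (k : ℝ → ℂ) u := hk
  have hneg : Measure.QuasiMeasurePreserving (fun x : ℝ ↦ -x) volume volume :=
    (Measure.measurePreserving_neg (volume : Measure ℝ)).quasiMeasurePreserving
  have hae := (memLp_invT k).coeFn_toLp
  have hae' := hneg.ae hae
  have hk'' := quasiMeasurePreserving_inv_real.ae hk'
  simp only [evenL2, Set.mem_setOf_eq]
  filter_upwards [hae, hae', hk''] with t h1 h2 h3
  rw [h2, h1, inv_neg, h3, abs_neg]

/-- **`I` maps `K_λ` into `H_{1/λ}`** ("`H_Λ = I K_{λ,λ}` avec `λ = 1/Λ`"): for `k ∈ K_λ`, `λ > 0`, the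
class `Ik` of `t ↦ k(t⁻¹)/|t|` satisfies `memHLambda λ⁻¹`, with witness `g = k` for the `𝒢`-clause.
[cite: Burnol2001CRAS, §2 (TeX l.410–418)] -/
private theorem memHLambda_toLp_invT {lam : ℝ} (hlam : 0 < lam) {k : Lp ℂ 2 (volume : Measure ℝ)}
    (hk : k ∈ sonineK lam) :
    memHLambda lam⁻¹ ((memLp_invT k).toLp (fun t : ℝ ↦ (k : ℝ → ℂ) t⁻¹ / ((|t| : ℝ) : ℂ))) := by
  obtain ⟨hke, hk0, hk1⟩ := hk
  have hke' : ∀ᵐ u : ℝ, (k : ℝ → ℂ) (-u) = (k : ℝ → ℂ) u := hke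
  have hneg : Measure.QuasiMeasurePreserving (fun x : ℝ ↦ -x) volume volume :=
    (Measure.measurePreserving_neg (volume : Measure ℝ)).quasiMeasurePreserving
  have hk0' : ∀ᵐ u : ℝ, |u| < lam → u ≠ 0 → (k : ℝ → ℂ) u = 0 := by
    have h := hneg.ae hk0
    filter_upwards [hk0, h, hke'] with u h1 h2 h3 hu hu0
    rcases lt_or_gt_of_ne hu0 with hneg' | hpos
    · rw [← h3]
      exact h2 ⟨by linarith, by rw [abs_of_neg hneg'] at hu; linarith⟩
    · exact h1 ⟨hpos, by rwa [abs_of_pos hpos] at hu⟩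
  have hae := (memLp_invT k).coeFn_toLp
  refine ⟨toLp_invT_mem_evenL2 hke, ?_, ⟨k, ae_invT_invT k, ?_⟩⟩
  · have h := quasiMeasurePreserving_inv_real.ae hk0'
    filter_upwards [hae, h] with t h1 h2 ht
    have ht0 : t ≠ 0 := by
      rintro rfl
      rw [abs_zero] at ht
      exact absurd ht (not_lt.2 (inv_pos.2 hlam).le)
    have hlt : |t⁻¹| < lam := by
      rw [abs_inv]
      calc |t|⁻¹ < lam⁻¹⁻¹ := by
            apply inv_strictAnti₀ (inv_pos.2 hlam) ht
        _ = lam := inv_inv lam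
    rw [h1, h2 hlt (inv_ne_zero ht0), zero_div]
  · rw [inv_inv]
    have hFe : ∀ᵐ u : ℝ, ((𝓕 k : Lp ℂ 2 (volume : Measure ℝ)) : ℝ → ℂ) (-u) =
        ((𝓕 k : Lp ℂ 2 (volume : Measure ℝ)) : ℝ → ℂ) u := fourier_mem_evenL2 hke
    have h := hneg.ae hk1
    filter_upwards [hk1, h, hFe, ae_ne_zero_real] with u h1 h2 h3 hu0 hu
    rcases lt_or_gt_of_ne hu0 with hneg' | hpos
    · rw [← h3]
      exact h2 ⟨by linarith, by rw [abs_of_neg hneg'] at hu; linarith⟩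
    · exact h1 ⟨hpos, by rwa [abs_of_pos hpos] at hu⟩

end InversionTransport

section MellinSide

/-! ### §2. The Mellin side of `I`: `∫₀^∞ (Ik)(t) t^{s−1} dt = k̂(1 − s)` and the completed transform -/

/-- `∫₀^∞ k(t⁻¹)|t|⁻¹ t^{s−1} dt = ∫₀^∞ k(u) u^{−s} du` (`= mellin k (1 − s)`; substitution `u = 1/t`,
no convergence hypothesis). [cite: Burnol2001CRAS, §2 (TeX l.410–418, 437–440)] -/
theorem mellin_invT (k : ℝ → ℂ) (s : ℂ) :
    mellin (fun t : ℝ ↦ k t⁻¹ / ((|t| : ℝ) : ℂ)) s = mellin k (1 - s) := by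
  have h1 : mellin (fun t : ℝ ↦ k t⁻¹ / ((|t| : ℝ) : ℂ)) s =
      mellin (fun t : ℝ ↦ (t : ℂ) ^ (-1 : ℂ) • (fun u : ℝ ↦ k u⁻¹) t) s := by
    simp only [mellin]
    refine setIntegral_congr_fun measurableSet_Ioi fun t (ht : 0 < t) ↦ ?_
    have ht0 : (t : ℂ) ≠ 0 := by exact_mod_cast ht.ne'
    simp only [abs_of_pos ht, smul_eq_mul, cpow_neg_one, div_eq_inv_mul]
  rw [h1, mellin_cpow_smul, mellin_comp_inv]
  congr 1
  ring

/-- For `k ∈ K_λ`, the **entire completed Mellin transform `𝒢_k` of Burnol 2004 is a completed Mellin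
transform of `Ik ∈ H_{1/λ}`** in the sense of Prop. 2.2: `𝒢_k` is entire and
`𝒢_k(s) = Γ_ℝ(s)·∫₀^∞ (Ik)(t)t^{s−1}dt` for `Re s > 1/2`.
[cite: Burnol2001CRAS, §2 (TeX l.437–441); Burnol2004b, Thm. 2.1 (arXiv:math/0203120v7 p. 5)] -/
theorem isCompletedMellin_toLp_invT {lam : ℝ} (hlam : 0 < lam) {k : Lp ℂ 2 (volume : Measure ℝ)}
    (hk : k ∈ sonineK lam) :
    IsCompletedMellin ((memLp_invT k).toLp (fun t : ℝ ↦ (k : ℝ → ℂ) t⁻¹ / ((|t| : ℝ) : ℂ)))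
      (completedMellinEntire (k : ℝ → ℂ)) := by
  refine ⟨(hasCompletedMellinEntire_of_mem_sonineK hlam hk).1, fun s hs ↦ ?_⟩
  have hk' : k ∈ (soninSpace lam lam : Set (Lp ℂ 2 (volume : Measure ℝ))) := by
    rw [← sonineK_eq_soninSpace]; exact hk
  obtain ⟨heven, hka, hFb⟩ := hk'
  have hΓ : Gammaℝ s ≠ 0 := Gammaℝ_ne_zero_of_re_pos (by linarith)
  have hmel : mellin (((memLp_invT k).toLp (fun t : ℝ ↦ (k : ℝ → ℂ) t⁻¹ / ((|t| : ℝ) : ℂ)) :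
      Lp ℂ 2 (volume : Measure ℝ)) : ℝ → ℂ) s = mellin (k : ℝ → ℂ) (1 - s) := by
    rw [← mellin_invT]
    simp only [mellin]
    refine integral_congr_ae ?_
    filter_upwards [ae_restrict_of_ae (memLp_invT k).coeFn_toLp] with t ht
    rw [ht]
  have hw : (1 - s).re < 1 / 2 := by rw [sub_re, one_re]; linarith
  rw [hmel, completedMellinEntire_eq_Gammaℝ_mul_of_mem_sonineK hlam hk hΓ,
    sonineMellinExt_eq_mellin hlam hlam k heven hka hFb hw]

end MellinSide

section Dictionary

/-! ### §3. Dictionary: the entire completed transform `𝒢_k` versus the pairing functionals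
`(k, X^λ_{w,i}]` of Théorème 1.5 -/

/-- `Γ_ℝ` is differentiable where it does not vanish (`1/Γ_ℝ` is entire). [folklore] -/
private theorem differentiableAt_Gammaℝ {z : ℂ} (hz : Gammaℝ z ≠ 0) : DifferentiableAt ℂ Gammaℝ z := by
  have h := differentiable_Gammaℝ_inv.differentiableAt (x := z)
  have h2 := h.inv (inv_ne_zero hz)
  have h3 : (fun s : ℂ ↦ (Gammaℝ s)⁻¹)⁻¹ = Gammaℝ := by funext s; simp
  have h4 : DifferentiableAt ℂ (fun s : ℂ ↦ (Gammaℝ s)⁻¹)⁻¹ z := h2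
  rwa [h3] at h4

/-- For `k ∈ K_{λ,λ}` with entire Mellin continuation `G` (Théorème 1.1): `𝒢_k(v) = Γ_ℝ(v)·G(1 − v)`
wherever `Γ_ℝ(v) ≠ 0` (`𝒢_k` = Burnol 2004's entire completed RIGHT Mellin transform, `G` the entire
continuation of the LEFT Mellin transform, `k̂_right(v) = k̂_left(1 − v)`).
[cite: Burnol2001CRAS, §2 (TeX l.437–441); Burnol2004b, Thm. 2.1 (arXiv:math/0203120v7 p. 5)] -/
theorem completedMellinEntire_eq_Gammaℝ_mul_of_hasEntireMellin {lam : ℝ} (hlam : 0 < lam)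
    {k : Lp ℂ 2 (volume : Measure ℝ)} (hk : k ∈ soninSpace lam lam) {G : ℂ → ℂ}
    (hG : HasEntireMellin k G) {v : ℂ} (hv : Gammaℝ v ≠ 0) :
    completedMellinEntire (k : ℝ → ℂ) v = Gammaℝ v * G (1 - v) := by
  have hkK : k ∈ sonineK lam := by rw [sonineK_eq_soninSpace]; exact hk
  rw [completedMellinEntire_eq_Gammaℝ_mul_of_mem_sonineK hlam hkK hv, hG.eq_sonineMellinExt hlam hk]

/-- For `k ∈ K_{λ,λ}` with Mellin data `(G, P)` (`P` the compensated pairing function of eq. (1.1)):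
`𝒢_k(v) = Γ_ℝ(1 − v)·P(v)` wherever `Γ_ℝ(1 − v) ≠ 0` (functional equation `𝒢_{𝓕k}(s) = 𝒢_k(1 − s)`
and `P = G_{𝓕k}`). [cite: Burnol2001CRAS, §1 eq. (1.1) and §2 (TeX l.279–281, 398–403, 437–441)] -/
theorem completedMellinEntire_eq_Gammaℝ_one_sub_mul_of_isXPairingFnC {lam : ℝ} (hlam : 0 < lam)
    {k : Lp ℂ 2 (volume : Measure ℝ)} (hk : k ∈ soninSpace lam lam) {G P : ℂ → ℂ}
    (hG : HasEntireMellin k G) (hP : IsXPairingFnC G P) {v : ℂ} (hv : Gammaℝ (1 - v) ≠ 0) :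
    completedMellinEntire (k : ℝ → ℂ) v = Gammaℝ (1 - v) * P v := by
  have hkK : k ∈ sonineK lam := by rw [sonineK_eq_soninSpace]; exact hk
  have hFk : (𝓕 k : Lp ℂ 2 (volume : Measure ℝ)) ∈ sonineK lam := fourier_mem_sonineK hkK
  obtain ⟨-, hFF⟩ := fourier_mem_soninSpace_swap hk
  have hFFk : (𝓕 (𝓕 k : Lp ℂ 2 (volume : Measure ℝ)) : Lp ℂ 2 (volume : Measure ℝ)) ∈ sonineK lam :=
    fourier_mem_sonineK hFk
  have h1 : completedMellinEntire (k : ℝ → ℂ) v =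
      completedMellinEntire ((𝓕 k : Lp ℂ 2 (volume : Measure ℝ)) : ℝ → ℂ) (1 - v) := by
    have h := completedMellinEntire_fourier_eq_of_mem_sonineK hlam hFk
    rw [hFF] at h
    rw [h]
  rw [h1, completedMellinEntire_eq_Gammaℝ_mul_of_mem_sonineK hlam hFk hv, hFF, sub_sub_cancel,
    hP.eq_sonineMellinExt hlam hk hG]

/-- **The dictionary.** For `k ∈ K_{λ,λ}` with Mellin data `(G, P)`, every `w ∈ ℂ` and `n ∈ ℕ`:
`𝒢_k^{(n)}(w) = Σ_{i ≤ n} C(n,i) · (k, X^λ_{w,i}] · h_w^{(n−i)}(w)`, where `(k, X^λ_{w,i}] = xPairingR G P w i`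
is the pairing functional of Théorème 1.5 and `h_w = Γ_ℝ` for `Re w > 1/2`, `h_w = Γ_ℝ(1 − ·)` for
`Re w ≤ 1/2` (Leibniz' rule on `𝒢_k = Γ_ℝ · G(1−·)`, resp. `𝒢_k = Γ_ℝ(1−·) · P`, near `w`).
[cite: Burnol2001CRAS, §1 (TeX l.393–403) and §2 (TeX l.437–466)] -/
theorem iteratedDeriv_completedMellinEntire_eq_sum {lam : ℝ} (hlam : 0 < lam)
    {k : Lp ℂ 2 (volume : Measure ℝ)} (hk : k ∈ soninSpace lam lam) {G P : ℂ → ℂ}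
    (hG : HasEntireMellin k G) (hP : IsXPairingFnC G P) (w : ℂ) (n : ℕ) :
    iteratedDeriv n (completedMellinEntire (k : ℝ → ℂ)) w =
      ∑ i ∈ Finset.range (n + 1), (n.choose i : ℂ) * xPairingR G P w i *
        iteratedDeriv (n - i) (if 1 / 2 < w.re then Gammaℝ else fun v ↦ Gammaℝ (1 - v)) w := by
  by_cases hw : 1 / 2 < w.re
  · simp only [xPairingR, if_pos hw]
    set U : Set ℂ := {v | 0 < v.re} with hU
    have hUo : IsOpen U := isOpen_lt continuous_const Complex.continuous_re
    have hwU : w ∈ U := by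
      simp only [hU, mem_setOf_eq]
      linarith
    have hev : completedMellinEntire (k : ℝ → ℂ) =ᶠ[𝓝 w] fun v ↦ G (1 - v) * Gammaℝ v := by
      filter_upwards [hUo.mem_nhds hwU] with v hv
      rw [completedMellinEntire_eq_Gammaℝ_mul_of_hasEntireMellin hlam hk hG
        (Gammaℝ_ne_zero_of_re_pos hv), mul_comm]
    rw [hev.iteratedDeriv_eq n]
    have hf : ContDiffAt ℂ n (fun v ↦ G (1 - v)) w :=
      ((hG.1.contDiff (n := n)).comp (contDiff_const.sub contDiff_id)).contDiffAt
    have hg : ContDiffAt ℂ n Gammaℝ w := by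
      have hd : DifferentiableOn ℂ Gammaℝ U := fun v hv ↦
        (differentiableAt_Gammaℝ (Gammaℝ_ne_zero_of_re_pos hv)).differentiableWithinAt
      exact (hd.contDiffOn hUo).contDiffAt (hUo.mem_nhds hwU)
    rw [iteratedDeriv_fun_mul hf hg]
  · simp only [xPairingR, if_neg hw]
    set U : Set ℂ := {v | v.re < 1} with hU
    have hUo : IsOpen U := isOpen_lt Complex.continuous_re continuous_const
    have hwU : w ∈ U := by
      simp only [hU, mem_setOf_eq]
      linarith
    have hΓ : ∀ v ∈ U, Gammaℝ (1 - v) ≠ 0 := fun v hv ↦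
      Gammaℝ_ne_zero_of_re_pos (by simp only [hU, mem_setOf_eq] at hv; rw [sub_re, one_re]; linarith)
    have hev : completedMellinEntire (k : ℝ → ℂ) =ᶠ[𝓝 w] fun v ↦ P v * Gammaℝ (1 - v) := by
      filter_upwards [hUo.mem_nhds hwU] with v hv
      rw [completedMellinEntire_eq_Gammaℝ_one_sub_mul_of_isXPairingFnC hlam hk hG hP (hΓ v hv),
        mul_comm]
    rw [hev.iteratedDeriv_eq n]
    have hf : ContDiffAt ℂ n P w := (hP.1.contDiff (n := n)).contDiffAt
    have hg : ContDiffAt ℂ n (fun v ↦ Gammaℝ (1 - v)) w := by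
      have hd : DifferentiableOn ℂ (fun v ↦ Gammaℝ (1 - v)) U := fun v hv ↦
        ((differentiableAt_Gammaℝ (hΓ v hv)).comp v
          ((differentiableAt_const _).sub differentiableAt_id)).differentiableWithinAt
      exact (hd.contDiffOn hUo).contDiffAt (hUo.mem_nhds hwU)
    rw [iteratedDeriv_fun_mul hf hg]

end Dictionary

section Algebra

/-! ### §4. The triangular substitution and the assembly -/

open Finset in
/-- Rearrangement of `Σ_{(w,k) ∈ S} c_{w,k} Σ_{i ≤ k} C(k,i) X(w,i) D(w,k−i)` as a combination of the
`X(w,j)`, `(w,j) ∈ (fst S) × {0,…,max snd S}`, with coefficients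
`c'_{w,j} = Σ_{(w,k) ∈ S} c_{w,k} C(k,j) D(w,k−j)` (pure algebra). [folklore] -/
private theorem sum_rearrange [DecidableEq ℂ] (S : Finset (ℂ × ℕ)) (c : ℂ × ℕ → ℂ)
    (X D : ℂ → ℕ → ℂ) :
    ∑ p ∈ S, c p * ∑ i ∈ range (p.2 + 1), (p.2.choose i : ℂ) * X p.1 i * D p.1 (p.2 - i) =
      ∑ q ∈ S.image Prod.fst ×ˢ range (S.sup Prod.snd + 1),
        (∑ p ∈ S with p.1 = q.1, c p * (p.2.choose q.2 : ℂ) * D q.1 (p.2 - q.2)) * X q.1 q.2 := by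
  set K : ℕ := S.sup Prod.snd with hK
  set W : Finset ℂ := S.image Prod.fst with hW
  -- extend the inner sums to `range (K + 1)`
  have h1 : ∀ p ∈ S, c p * ∑ i ∈ range (p.2 + 1), (p.2.choose i : ℂ) * X p.1 i * D p.1 (p.2 - i) =
      ∑ i ∈ range (K + 1), c p * ((p.2.choose i : ℂ) * X p.1 i * D p.1 (p.2 - i)) := by
    intro p hp
    have hpK : p.2 ≤ K := by rw [hK]; exact le_sup (f := Prod.snd) hp
    rw [mul_sum]
    refine sum_subset (range_subset_range.2 (by omega)) fun i hi hi' ↦ ?_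
    have hlt : p.2 < i := by
      rw [Finset.mem_range] at hi hi'
      omega
    rw [Nat.choose_eq_zero_of_lt hlt, Nat.cast_zero, zero_mul, zero_mul, mul_zero]
  rw [sum_congr rfl h1, sum_comm, sum_product_right]
  refine sum_congr rfl fun i _ ↦ ?_
  rw [← sum_fiberwise_of_maps_to (g := Prod.fst) (t := W) (fun p hp ↦ mem_image_of_mem Prod.fst hp)]
  refine sum_congr rfl fun w _ ↦ ?_
  rw [sum_mul]
  refine sum_congr rfl fun p hp ↦ ?_
  rw [(mem_filter.1 hp).2]
  ring

open Finset in
/-- Triangular back-substitution: if the substituted coefficients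
`c'_{w,j} = Σ_{(w,k) ∈ S} c_{w,k} C(k,j) D(w,k−j)` all vanish and `D(w,0) ≠ 0`, then `c = 0` on `S`
(look at the largest `k` with `c_{w,k} ≠ 0`). [folklore] -/
private theorem eq_zero_of_triangular [DecidableEq ℂ] {S : Finset (ℂ × ℕ)} {c : ℂ × ℕ → ℂ}
    {D : ℂ → ℕ → ℂ} (hD : ∀ w, D w 0 ≠ 0)
    (h : ∀ q ∈ S.image Prod.fst ×ˢ range (S.sup Prod.snd + 1),
      ∑ p ∈ S with p.1 = q.1, c p * (p.2.choose q.2 : ℂ) * D q.1 (p.2 - q.2) = 0) :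
    ∀ p ∈ S, c p = 0 := by
  by_contra hne
  push Not at hne
  obtain ⟨p₁, hp₁S, hp₁⟩ := hne
  set w₀ : ℂ := p₁.1 with hw₀
  set T : Finset (ℂ × ℕ) := S.filter (fun p ↦ p.1 = w₀ ∧ c p ≠ 0) with hT
  have hTne : T.Nonempty := ⟨p₁, by rw [hT, mem_filter]; exact ⟨hp₁S, rfl, hp₁⟩⟩
  obtain ⟨p₀, hp₀T, hmax⟩ := exists_max_image T Prod.snd hTne
  obtain ⟨hp₀S, hp₀w, hp₀c⟩ := mem_filter.1 hp₀T
  set k₀ : ℕ := p₀.2 with hk₀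
  have hp₀eq : p₀ = (w₀, k₀) := Prod.ext hp₀w rfl
  have hq : (w₀, k₀) ∈ S.image Prod.fst ×ˢ range (S.sup Prod.snd + 1) := by
    rw [mem_product, Finset.mem_range]
    refine ⟨?_, Nat.lt_succ_of_le ?_⟩
    · exact mem_image.2 ⟨p₀, hp₀S, hp₀w⟩
    · show k₀ ≤ S.sup Prod.snd
      rw [hk₀]
      exact le_sup (f := Prod.snd) hp₀S
  have hsum := h _ hq
  dsimp only at hsum
  rw [sum_eq_single p₀] at hsum
  · rw [hk₀, Nat.choose_self, Nat.cast_one, mul_one, Nat.sub_self] at hsum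
    exact (mul_ne_zero hp₀c (hD w₀)) hsum
  · intro p hp hpne
    obtain ⟨hpS, hpw⟩ := mem_filter.1 hp
    rcases lt_trichotomy p.2 k₀ with hlt | heq | hgt
    · rw [Nat.choose_eq_zero_of_lt hlt, Nat.cast_zero, mul_zero, zero_mul]
    · exact absurd (Prod.ext (hpw.trans hp₀w.symm) (heq.trans hk₀.symm)) hpne
    · have hc0 : c p = 0 := by
        by_contra hc
        have hpT : p ∈ T := by rw [hT, mem_filter]; exact ⟨hpS, hpw, hc⟩
        exact absurd (hmax p hpT) (not_le.2 hgt)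
      rw [hc0, zero_mul, zero_mul]
  · intro hp₀
    exact absurd (mem_filter.2 ⟨hp₀S, hp₀w⟩) hp₀

/-- **Théorème 2.3 from Théorème 1.5.** If the pairing functionals `f ↦ (f, X^λ_{w,k}]`,
`(w,k) ∈ ℂ × ℕ`, are linearly independent on every `K_{λ,λ}` (Théorème 1.5, faithful form
`Burnol2001CRAS_thm1_5C`), then for every `Λ > 0` every assignment `(w,k) ↦ Z^Λ_{w,k}` of evaluators of
`H_Λ` is a linearly independent family (Théorème 2.3): a relation `Σ c_{w,k} Z^Λ_{w,k} = 0` paired with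
`Ik`, `k ∈ K_{1/Λ}` (§1–§2), is a relation `Σ c_{w,k} 𝒢_k^{(k)}(w) = 0`, i.e. (§3) a vanishing
combination of the pairing functionals whose coefficients determine `c` triangularly (§4).
[cite: Burnol2001CRAS, Théorème 2.3 (TeX l.475–477), §2 (TeX l.410–418, 463–466), Théorème 1.5 (TeX l.406–420)] -/
theorem Burnol2001CRAS_thm2_3_of_thm1_5C (h15 : Burnol2001CRAS_thm1_5C) : Burnol2001CRAS_thm2_3 := by
  classical
  intro Λ hΛ Z hZ
  rw [linearIndependent_iff']
  intro S c hsum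
  have hlam : 0 < Λ⁻¹ := inv_pos.2 hΛ
  -- the Gamma-factor derivatives `D(w, m) = h_w^{(m)}(w)` and `h_w(w) ≠ 0`
  set D : ℂ → ℕ → ℂ := fun w m ↦
    iteratedDeriv m (if 1 / 2 < w.re then Gammaℝ else fun v ↦ Gammaℝ (1 - v)) w with hD
  have hD0 : ∀ w, D w 0 ≠ 0 := by
    intro w
    simp only [hD, iteratedDeriv_zero]
    split_ifs with hw
    · exact Gammaℝ_ne_zero_of_re_pos (by linarith)
    · exact Gammaℝ_ne_zero_of_re_pos (by rw [sub_re, one_re]; linarith)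
  -- Step A: pairing the relation with `Ik`, `k ∈ K_{1/Λ}`, and the dictionary of §3
  have hA : ∀ k : Lp ℂ 2 (volume : Measure ℝ), k ∈ soninSpace Λ⁻¹ Λ⁻¹ → ∀ G P : ℂ → ℂ,
      HasEntireMellin k G → IsXPairingFnC G P →
      ∑ p ∈ S, c p * ∑ i ∈ Finset.range (p.2 + 1),
        (p.2.choose i : ℂ) * xPairingR G P p.1 i * D p.1 (p.2 - i) = 0 := by
    intro k hk G P hG hP
    have hkK : k ∈ sonineK Λ⁻¹ := by rw [sonineK_eq_soninSpace]; exact hk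
    set f : Lp ℂ 2 (volume : Measure ℝ) :=
      (memLp_invT k).toLp (fun t : ℝ ↦ (k : ℝ → ℂ) t⁻¹ / ((|t| : ℝ) : ℂ)) with hf_def
    have hf : memHLambda Λ f := by
      have h := memHLambda_toLp_invT hlam hkK
      rwa [inv_inv] at h
    have hM := isCompletedMellin_toLp_invT hlam hkK
    have hpair : ∀ p ∈ S, ∫ t in Ioi (0 : ℝ), (f : ℝ → ℂ) t * ((Z p : Lp ℂ 2 (volume : Measure ℝ)) :
        ℝ → ℂ) t = iteratedDeriv p.2 (completedMellinEntire (k : ℝ → ℂ)) p.1 :=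
      fun p _ ↦ (hZ p).2 f hf _ hM
    -- the relation, evaluated against `f`
    have hae : ∀ᵐ t : ℝ, ∑ p ∈ S, c p * ((Z p : Lp ℂ 2 (volume : Measure ℝ)) : ℝ → ℂ) t = 0 := by
      have h0 : ((∑ p ∈ S, c p • Z p : Lp ℂ 2 (volume : Measure ℝ)) : ℝ → ℂ) =ᵐ[volume] 0 := by
        rw [hsum]; exact Lp.coeFn_zero ℂ 2 volume
      have h1 := Lp.coeFn_fun_finsetSum S (fun p ↦ c p • Z p)
      have h2 : ∀ᵐ t : ℝ, ∀ p ∈ S, ((c p • Z p : Lp ℂ 2 (volume : Measure ℝ)) : ℝ → ℂ) t =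
          c p * ((Z p : Lp ℂ 2 (volume : Measure ℝ)) : ℝ → ℂ) t := by
        rw [Filter.eventually_all_finset]
        intro p _
        filter_upwards [Lp.coeFn_smul (c p) (Z p)] with t ht
        rw [ht, Pi.smul_apply, smul_eq_mul]
      filter_upwards [h0, h1, h2] with t ht0 ht1 ht2
      rw [← Finset.sum_congr rfl ht2, ← ht1, ht0, Pi.zero_apply]
    have hint : ∀ p ∈ S, Integrable (fun t : ℝ ↦ c p * ((f : ℝ → ℂ) t *
        ((Z p : Lp ℂ 2 (volume : Measure ℝ)) : ℝ → ℂ) t)) (volume.restrict (Ioi (0 : ℝ))) :=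
      fun p _ ↦ (((Lp.memLp f).integrable_mul (Lp.memLp (Z p))).integrableOn).const_mul (c p)
    have hzero : ∑ p ∈ S, c p * iteratedDeriv p.2 (completedMellinEntire (k : ℝ → ℂ)) p.1 = 0 := by
      calc ∑ p ∈ S, c p * iteratedDeriv p.2 (completedMellinEntire (k : ℝ → ℂ)) p.1
          = ∑ p ∈ S, ∫ t in Ioi (0 : ℝ), c p * ((f : ℝ → ℂ) t *
              ((Z p : Lp ℂ 2 (volume : Measure ℝ)) : ℝ → ℂ) t) := by
            refine Finset.sum_congr rfl fun p hp ↦ ?_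
            rw [← hpair p hp, integral_const_mul]
        _ = ∫ t in Ioi (0 : ℝ), ∑ p ∈ S, c p * ((f : ℝ → ℂ) t *
              ((Z p : Lp ℂ 2 (volume : Measure ℝ)) : ℝ → ℂ) t) := (integral_finsetSum S hint).symm
        _ = ∫ t in Ioi (0 : ℝ), (f : ℝ → ℂ) t *
              ∑ p ∈ S, c p * ((Z p : Lp ℂ 2 (volume : Measure ℝ)) : ℝ → ℂ) t := by
            refine integral_congr_ae (ae_of_all _ fun t ↦ ?_)
            dsimp only
            rw [Finset.mul_sum]
            exact Finset.sum_congr rfl fun p _ ↦ by ring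
        _ = ∫ t in Ioi (0 : ℝ), (0 : ℂ) := by
            refine integral_congr_ae ?_
            filter_upwards [ae_restrict_of_ae hae] with t ht
            rw [ht, mul_zero]
        _ = 0 := integral_zero _ _
    rw [← hzero]
    refine Finset.sum_congr rfl fun p _ ↦ ?_
    rw [iteratedDeriv_completedMellinEntire_eq_sum hlam hk hG hP p.1 p.2]
  -- Step B: the substituted coefficients vanish by Théorème 1.5
  set c' : ℂ × ℕ → ℂ := fun q ↦
    ∑ p ∈ S with p.1 = q.1, c p * (p.2.choose q.2 : ℂ) * D q.1 (p.2 - q.2) with hc'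
  have hB : ∀ f : Lp ℂ 2 (volume : Measure ℝ), f ∈ soninSpace Λ⁻¹ Λ⁻¹ → ∀ G P : ℂ → ℂ,
      HasEntireMellin f G → IsXPairingFnC G P →
      ∑ q ∈ S.image Prod.fst ×ˢ Finset.range (S.sup Prod.snd + 1), c' q * xPairingR G P q.1 q.2 = 0 := by
    intro k hk G P hG hP
    have h := hA k hk G P hG hP
    rw [sum_rearrange S c (fun w i ↦ xPairingR G P w i) D] at h
    simpa only [hc'] using h
  have hc'0 : ∀ q ∈ S.image Prod.fst ×ˢ Finset.range (S.sup Prod.snd + 1), c' q = 0 :=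
    h15 Λ⁻¹ hlam _ c' hB
  -- Step C: back-substitution
  exact eq_zero_of_triangular hD0 (fun q hq ↦ by simpa only [hc'] using hc'0 q hq)

/-- **Théorème 2.3 holds** (TeX l.475–477): *Les vecteurs `Z^Λ_{w,k}` pour `w ∈ ℂ`, `k ∈ ℕ` sont
linéairement indépendants* — for every `Λ > 0`, every assignment `(w,k) ↦ Z^Λ_{w,k}` of evaluators of
`H_Λ` (`IsEvaluatorZ`) is a linearly independent family; from the door
`Burnol2001CRAS_thm2_3_of_thm1_5C` and Théorème 1.5 (`Burnol2001CRAS_thm1_5C_holds`).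
[cite: Burnol2001CRAS, Théorème 2.3 (TeX l.475–477)] -/
theorem Burnol2001CRAS_thm2_3_holds : Burnol2001CRAS_thm2_3 :=
  Burnol2001CRAS_thm2_3_of_thm1_5C Burnol2001CRAS_thm1_5C_holds

end Algebra

end Burnol2001

end Literature.Analysis.DeBrangesSpaces

end
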